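import Summits.AtomisticToContinuum.Crystallization.Theorems.PalmUnimodularRigidityLayeredLawsSelectHcpDefs
import Literature.Probability.Process.PointStationaryLaw
import Mathlib.Topology.MetricSpace.HausdorffDistance
import Mathlib.MeasureTheory.Measure.GiryMonad
import Mathlib.Topology.Metrizable.Basic
import Mathlib.Topology.Order.Monotone
import HarnessLib

/-!
# Route `ReggeStarCoercivity`, crux `DefectFreeCrystallizes` (stmt-AtomisticToContinuum-13603), line `palm-good-law`
# (skeleton v27, stub V `stub_defectVersion`): A GIRY-MEASURABLE VERSION OF THE CONGRUENCE DEFECT OF THE ROOT STAR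

**Theorem** (`stub_defectVersion`).  For every finite reference family `ref : Fin n → ℝ³` and every `δ > 0` there
is a measurable `Dm : Measure ℝ³ → ℝ≥0∞`, bounded by `ofReal (∑ i, (‖ref i‖ + 11/10)²)`, which on every rooted
`δ`-hard-core configuration `μ = count|S` equals
`ofReal (⨅_{A : ℝ³ ≃ₗᵢ[ℝ] ℝ³} ∑ i, infDist (A (ref i)) (rootStar μ)²)`, where `rootStar μ` is the set of atoms
`y` (`μ {y} ≠ 0`) with `0 < ‖y‖ ≤ 11/10`.

**Proof.**
* On a counting measure `count|S` the root star is `S ∩ T`, `T = {0 < ‖y‖ ≤ 11/10}` (`rootStar_count_restrict`).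
* The DISTANCE VERSION `⨅_{r ∈ ℚ} [0 < μ (B(x, r) ∩ T)] ofReal r` is Giry-measurable in `μ` (countable infimum of
  `if`s over the measurable evaluations `μ ↦ μ B`, `Measure.measurable_coe`; `measurable_distVersion`), and on a
  counting measure with non-empty star `S ∩ T` it IS `ofReal (infDist x (S ∩ T))`: `count|S` charges `B(x, r) ∩ T` iff
  the star meets `B(x, r)` iff `infDist x star < r` (`Metric.infDist_lt_iff`), and the rationals are dense
  (`distVersion_count_restrict`).
* COUNTABLE REDUCTION OF THE ISOMETRY INFIMUM.  Only the tuple `(A (ref i))_i ∈ (Fin n → ℝ³)` enters; the range of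
  `A ↦ (A (ref i))_i` lies in a second-countable space, hence has a countable dense subset `t`
  (`IsSeparable.exists_countable_dense_subset`), and the infimum over all isometries of the CONTINUOUS
  `p ↦ ofReal (∑ i, infDist (p i) star ^ 2)` equals the infimum over `t` (`iInf_subtype_eq_iInf_of_dense`);
  `ofReal` commutes with the (bounded below, non-empty) real infimum (`Monotone.map_ciInf_of_continuousAt`).
* `Dm μ = if μ T = 0 then 0 else min (⨅_{p ∈ t} ∑ i, (distance version at p i)²) (ofReal bound)`
  (`exists_measurable_version`): measurable, trivially bounded; on a counting measure with EMPTY star the defect is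
  `⨅_A ∑ 0² = 0` (`Metric.infDist_empty`), and with NON-EMPTY star the true defect is at most the bound (take `A = 1`
  and any star point `y`: `infDist ≤ dist (ref i) y ≤ ‖ref i‖ + 11/10`), so the `min` is inactive.
The hard-core separation is not used (the agreement holds for every counting measure).  All `[folklore]`.
-/

noncomputable section

namespace Summit.AtomisticToContinuum.Crystallization.Theorems.PalmGoodLaw.DefectVersion

open scoped BigOperators ENNReal
open MeasureTheory Set Metric
open Literature.Probability.Process
open Summit.AtomisticToContinuum.Crystallization.Theorems.PalmUnimodularRigidity.LayeredLawsSelectHcp (rootStar)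

section General

variable {E : Type*} [PseudoMetricSpace E] [MeasurableSpace E] [OpensMeasurableSpace E]

/-- **The distance version is measurable.**  For a measurable `T` and a point `x`, the functional
`μ ↦ ⨅_{r ∈ ℚ} [0 < μ (B(x, r) ∩ T)] ofReal r` is measurable for the Giry σ-algebra (countable infimum of measurable
`if`s over the evaluations `μ ↦ μ B`). [folklore] -/
theorem measurable_distVersion {T : Set E} (hT : MeasurableSet T) (x : E) :
    Measurable fun μ : Measure E => ⨅ r : ℚ, if 0 < μ (ball x r ∩ T) then ENNReal.ofReal r else (⊤ : ℝ≥0∞) := by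
  refine Measurable.iInf fun r => Measurable.ite ?_ measurable_const measurable_const
  exact measurableSet_lt measurable_const (Measure.measurable_coe (measurableSet_ball.inter hT))

/-- **The distance version on counting measures.**  On `count|S` with `S ∩ T` non-empty the distance version at `x` IS
`ofReal (infDist x (S ∩ T))`: `count|S` charges `B(x, r) ∩ T` iff `S ∩ T` meets `B(x, r)` iff `infDist x (S ∩ T) < r`,
and the rationals are dense. [folklore] -/
theorem distVersion_count_restrict {T : Set E} (hT : MeasurableSet T) {S : Set E} (hne : (S ∩ T).Nonempty) (x : E) :
    (⨅ r : ℚ, if 0 < (Measure.count : Measure E).restrict S (ball x r ∩ T) then ENNReal.ofReal r else (⊤ : ℝ≥0∞)) =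
      ENNReal.ofReal (infDist x (S ∩ T)) := by
  have key : ∀ r : ℚ,
      0 < (Measure.count : Measure E).restrict S (ball x r ∩ T) ↔ infDist x (S ∩ T) < r := by
    intro r
    rw [Measure.restrict_apply (measurableSet_ball.inter hT), pos_iff_ne_zero, Measure.count_ne_zero_iff,
      infDist_lt_iff hne]
    constructor
    · rintro ⟨y, ⟨hyb, hyT⟩, hyS⟩
      exact ⟨y, ⟨hyS, hyT⟩, mem_ball'.1 hyb⟩
    · rintro ⟨y, ⟨hyS, hyT⟩, hy⟩
      exact ⟨y, ⟨mem_ball'.2 hy, hyT⟩, hyS⟩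
  apply le_antisymm
  · refine ENNReal.le_of_forall_pos_le_add fun ε hε _ => ?_
    obtain ⟨q, hq₁, hq₂⟩ := exists_rat_btwn (lt_add_of_pos_right (infDist x (S ∩ T)) (NNReal.coe_pos.2 hε))
    calc (⨅ r : ℚ, if 0 < (Measure.count : Measure E).restrict S (ball x r ∩ T) then ENNReal.ofReal r else (⊤ : ℝ≥0∞))
        ≤ ENNReal.ofReal q := iInf_le_of_le q (by rw [if_pos ((key q).2 hq₁)])
      _ ≤ ENNReal.ofReal (infDist x (S ∩ T) + ε) := ENNReal.ofReal_le_ofReal hq₂.le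
      _ = ENNReal.ofReal (infDist x (S ∩ T)) + ε := by
          rw [ENNReal.ofReal_add infDist_nonneg ε.coe_nonneg, ENNReal.ofReal_coe_nnreal]
  · refine le_iInf fun r => ?_
    split_ifs with h
    · exact ENNReal.ofReal_le_ofReal ((key r).1 h).le
    · exact le_top

/-- **Dense reduction of an infimum.**  For a continuous `f` into `ℝ≥0∞` and `t ⊆ range Φ` with `range Φ ⊆ closure t`,
the infimum of `f` over `t` equals the infimum of `f ∘ Φ`. [folklore] -/
theorem iInf_subtype_eq_iInf_of_dense {X I : Type*} [TopologicalSpace X] {f : X → ℝ≥0∞} (hf : Continuous f)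
    {Φ : I → X} {t : Set X} (ht : t ⊆ range Φ) (hdense : range Φ ⊆ closure t) :
    ⨅ p : t, f p = ⨅ a : I, f (Φ a) := by
  apply le_antisymm
  · refine le_iInf fun a => le_of_forall_gt fun c hc => ?_
    obtain ⟨p, hpc, hpt⟩ :=
      mem_closure_iff.1 (hdense (mem_range_self a)) {p | f p < c} (isOpen_lt hf continuous_const) hc
    exact (iInf_le (fun p : t => f p) ⟨p, hpt⟩).trans_lt hpc
  · refine le_iInf fun p => ?_
    obtain ⟨a, ha⟩ := ht p.2
    exact iInf_le_of_le a (by rw [ha])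

end General

/-- **Measurable version of the congruence defect against `S ∩ T`.**  For a finite reference family `ref`, a measurable
`T` inside the closed ball of radius `R`, there is a measurable `Dm : Measure ℝ³ → ℝ≥0∞`, bounded by
`ofReal (∑ i, (‖ref i‖ + R)²)`, with `Dm (count|S) = ofReal (⨅_A ∑ i, infDist (A (ref i)) (S ∩ T)²)` for EVERY `S`:
`Dm μ = if μ T = 0 then 0 else min (⨅_{p ∈ t} ∑ i, (distance version of μ at p i)²) (ofReal bound)` for a countable
dense subset `t` of the tuples `(A (ref i))_i` (see the module docstring). [folklore] -/
theorem exists_measurable_version {n : ℕ} (ref : Fin n → EuclideanSpace ℝ (Fin 3)) {T : Set (EuclideanSpace ℝ (Fin 3))}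
    (hT : MeasurableSet T) {R : ℝ} (hTR : ∀ y ∈ T, ‖y‖ ≤ R) :
    ∃ Dm : Measure (EuclideanSpace ℝ (Fin 3)) → ℝ≥0∞, Measurable Dm ∧
      (∀ μ : Measure (EuclideanSpace ℝ (Fin 3)), Dm μ ≤ ENNReal.ofReal (∑ i, (‖ref i‖ + R) ^ 2)) ∧
      ∀ S : Set (EuclideanSpace ℝ (Fin 3)),
        Dm ((Measure.count : Measure (EuclideanSpace ℝ (Fin 3))).restrict S) =
          ENNReal.ofReal (⨅ A : EuclideanSpace ℝ (Fin 3) ≃ₗᵢ[ℝ] EuclideanSpace ℝ (Fin 3),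
            ∑ i, infDist (A (ref i)) (S ∩ T) ^ 2) := by
  classical
  -- a countable dense subset `t` of the tuples `(A (ref i))_i`
  obtain ⟨t, htΦ, htc, hdense⟩ := (TopologicalSpace.IsSeparable.of_separableSpace
    (range fun (A : EuclideanSpace ℝ (Fin 3) ≃ₗᵢ[ℝ] EuclideanSpace ℝ (Fin 3)) (i : Fin n) => A (ref i))).exists_countable_dense_subset
  haveI : Countable t := htc.to_subtype
  refine ⟨fun μ => if μ T = 0 then 0 else
      min (⨅ p : t, ∑ i, (⨅ r : ℚ, if 0 < μ (ball (p.1 i) r ∩ T) then ENNReal.ofReal r else (⊤ : ℝ≥0∞)) ^ 2)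
        (ENNReal.ofReal (∑ i, (‖ref i‖ + R) ^ 2)), ?_, ?_, ?_⟩
  · -- measurability
    exact Measurable.ite (Measure.measurable_coe hT (measurableSet_singleton 0)) measurable_const
      ((Measurable.iInf fun p => Finset.measurable_sum _ fun i _ =>
        (measurable_distVersion hT (p.1 i)).pow_const 2).min measurable_const)
  · -- the bound
    intro μ
    dsimp only
    split_ifs
    · exact bot_le
    · exact min_le_right _ _
  · -- agreement on counting measures
    intro S
    dsimp only
    split_ifs with h0
    · -- empty star: the defect is `⨅_A ∑ 0² = 0`
      rw [Measure.restrict_apply hT, Measure.count_eq_zero_iff, inter_comm] at h0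
      rw [h0]
      simp only [infDist_empty, ne_eq, OfNat.ofNat_ne_zero, not_false_eq_true, zero_pow, Finset.sum_const_zero,
        ciInf_const, ENNReal.ofReal_zero]
    · -- non-empty star
      have hne : (S ∩ T).Nonempty := by
        rwa [Measure.restrict_apply hT, ← ne_eq, Measure.count_ne_zero_iff, inter_comm] at h0
      -- the true defect obeys the bound (take `A = 1` and any star point)
      have hbdd : BddBelow (range fun A : EuclideanSpace ℝ (Fin 3) ≃ₗᵢ[ℝ] EuclideanSpace ℝ (Fin 3) =>
          ∑ i, infDist (A (ref i)) (S ∩ T) ^ 2) :=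
        ⟨0, forall_mem_range.2 fun A => Finset.sum_nonneg fun i _ => sq_nonneg _⟩
      have hle : (⨅ A : EuclideanSpace ℝ (Fin 3) ≃ₗᵢ[ℝ] EuclideanSpace ℝ (Fin 3),
          ∑ i, infDist (A (ref i)) (S ∩ T) ^ 2) ≤ ∑ i, (‖ref i‖ + R) ^ 2 := by
        obtain ⟨y, hyS, hyT⟩ := hne
        refine ciInf_le_of_le hbdd (LinearIsometryEquiv.refl ℝ (EuclideanSpace ℝ (Fin 3)))
          (Finset.sum_le_sum fun i _ => pow_le_pow_left₀ infDist_nonneg ?_ 2)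
        rw [LinearIsometryEquiv.coe_refl, id]
        exact (infDist_le_dist_of_mem (mem_inter hyS hyT)).trans
          ((dist_le_norm_add_norm _ _).trans (add_le_add le_rfl (hTR y hyT)))
      -- the countable infimum IS the defect
      have hcont : Continuous fun p : Fin n → EuclideanSpace ℝ (Fin 3) =>
          ENNReal.ofReal (∑ i, infDist (p i) (S ∩ T) ^ 2) :=
        ENNReal.continuous_ofReal.comp
          (continuous_finsetSum _ fun i _ => ((continuous_infDist_pt _).comp (continuous_apply i)).pow 2)
      have hG_eq : (⨅ p : t, ∑ i, (⨅ r : ℚ,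
            if 0 < (Measure.count : Measure (EuclideanSpace ℝ (Fin 3))).restrict S (ball (p.1 i) r ∩ T)
            then ENNReal.ofReal r else (⊤ : ℝ≥0∞)) ^ 2) =
          ENNReal.ofReal (⨅ A : EuclideanSpace ℝ (Fin 3) ≃ₗᵢ[ℝ] EuclideanSpace ℝ (Fin 3),
            ∑ i, infDist (A (ref i)) (S ∩ T) ^ 2) := by
        have h1 : (⨅ p : t, ∑ i, (⨅ r : ℚ,
              if 0 < (Measure.count : Measure (EuclideanSpace ℝ (Fin 3))).restrict S (ball (p.1 i) r ∩ T)
              then ENNReal.ofReal r else (⊤ : ℝ≥0∞)) ^ 2) =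
            ⨅ p : t, ENNReal.ofReal (∑ i, infDist (p.1 i) (S ∩ T) ^ 2) := by
          refine iInf_congr fun p => ?_
          rw [ENNReal.ofReal_sum_of_nonneg fun i _ => sq_nonneg _]
          refine Finset.sum_congr rfl fun i _ => ?_
          rw [distVersion_count_restrict hT hne, ENNReal.ofReal_pow infDist_nonneg]
        rw [h1, iInf_subtype_eq_iInf_of_dense hcont htΦ hdense]
        exact (ENNReal.ofReal_mono.map_ciInf_of_continuousAt ENNReal.continuous_ofReal.continuousAt hbdd).symm
      rw [hG_eq, min_eq_left (ENNReal.ofReal_le_ofReal hle)]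

/-- The star shell `{y | 0 < ‖y‖ ≤ 11/10}` is a Borel set. [folklore] -/
theorem measurableSet_shell : MeasurableSet {y : EuclideanSpace ℝ (Fin 3) | 0 < ‖y‖ ∧ ‖y‖ ≤ 11 / 10} :=
  (measurableSet_lt measurable_const measurable_norm).inter (measurableSet_le measurable_norm measurable_const)

/-- On a counting measure `count|S` the root star is `S ∩ {y | 0 < ‖y‖ ≤ 11/10}`. [folklore] -/
theorem rootStar_count_restrict (S : Set (EuclideanSpace ℝ (Fin 3))) :
    rootStar ((Measure.count : Measure (EuclideanSpace ℝ (Fin 3))).restrict S) =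
      S ∩ {y : EuclideanSpace ℝ (Fin 3) | 0 < ‖y‖ ∧ ‖y‖ ≤ 11 / 10} := by
  ext y
  simp only [rootStar, mem_setOf_eq, mem_inter_iff, count_restrict_singleton_ne_zero_iff]

/-- **`stub_defectVersion`** (V of line `palm-good-law`, skeleton v27): A GIRY-MEASURABLE VERSION OF THE CONGRUENCE
DEFECT.  For every finite reference family `ref : Fin n → ℝ³` and hard core `δ > 0` there is a measurable, explicitly
bounded `Dm : Measure ℝ³ → ℝ≥0∞` which on rooted `δ`-hard-core configurations `μ = count|S` equals
`ofReal (⨅_{A ∈ O(3)} Σ_i infDist(A(ref i), rootStar μ)²)` — `exists_measurable_version` with `T` the star shell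
(`rootStar (count|S) = S ∩ T`, `rootStar_count_restrict`). [folklore] -/
theorem stub_defectVersion :
    ∀ (n : ℕ) (ref : Fin n → EuclideanSpace ℝ (Fin 3)) (δ : ℝ), 0 < δ →
      ∃ Dm : Measure (EuclideanSpace ℝ (Fin 3)) → ℝ≥0∞, Measurable Dm ∧
        (∀ μ : Measure (EuclideanSpace ℝ (Fin 3)), Dm μ ≤ ENNReal.ofReal (∑ i, (‖ref i‖ + 11 / 10) ^ 2)) ∧
        ∀ μ : Measure (EuclideanSpace ℝ (Fin 3)), IsRootedHardCore δ μ →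
          Dm μ = ENNReal.ofReal
            (⨅ A : EuclideanSpace ℝ (Fin 3) ≃ₗᵢ[ℝ] EuclideanSpace ℝ (Fin 3),
              ∑ i, Metric.infDist (A (ref i)) (Summit.AtomisticToContinuum.Crystallization.Theorems.PalmUnimodularRigidity.LayeredLawsSelectHcp.rootStar μ) ^ 2) := by
  intro n ref δ _
  obtain ⟨Dm, hm, hle, heq⟩ := exists_measurable_version ref measurableSet_shell (R := 11 / 10) fun y hy => hy.2
  refine ⟨Dm, hm, hle, ?_⟩
  rintro μ ⟨S, -, -, rfl⟩
  rw [rootStar_count_restrict, heq]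

end Summit.AtomisticToContinuum.Crystallization.Theorems.PalmGoodLaw.DefectVersion

end
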